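import Literature.Geometry.Lorentzian.Hypersurface
import Literature.Geometry.Lorentzian.ConnectionNaturality
import Literature.Geometry.Lorentzian.GeodesicProofs
import Literature.Geometry.Lorentzian.SecondFundamentalFormApply
import HarnessLib

/-!
# Naturality of the covariant derivative along curves, of the second fundamental form and of the
mean curvature under local diffeomorphisms

Support file (all results proved) for the geometric half of Sweeney 2026, Prop. 1.2
(`Literature.Geometry.Riemannian.Sweeney2026_pscMeanConvex`, file
`Geometry/Riemannian/MeanConvexContractible.lean`): a metric pulled back along an equidimensional
immersion `Φ : N → M` (`PseudoRiemannianMetric.comap`, the canonical local isometry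
`Φ : (N, Φ^* g) → (M, g)`) has "the same" extrinsic geometry of hypersurfaces as `g`.

Continuing `ConnectionNaturality.lean` (`∇^{Φ^*g}_v (Φ^*Y) = (dΦ)⁻¹ ∇^g_{dΦ v} Y`) we prove, for
`Φ : N → M` a smooth map between manifolds of the same dimension all of whose differentials are
injective, `g` a smooth metric on `M` and `Φ^* g` its pullback:

* `mfderiv_covariantDerivAlong_comap` — **the induced covariant derivative along curves is
  natural**: `dΦ (D^{Φ^*g} W/dt) = D^{g} (dΦ W)/dt` along `Φ ∘ γ`, for every vector field `W` along a
  curve `γ` in `N` whose lift to `TN` is differentiable (O'Neill 1983, Ch. 3, Prop. 3.59 with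
  Prop. 3.18; the frame-change computation of `covariantDerivAlongFrame_eq_of_mem_baseSet` in
  `GeodesicProofs.lean`, run with the pulled-back frame `Φ^* s'ⱼ` of the canonical frame `s'ⱼ` of
  `TM` at `Φ (γ t₀)`);
* `mfderiv_normalDerivAlong_comap` — `dΦ (D^{Φ^*g}_v ν) = D^{g}_v (dΦ ν)` for a field `ν` along a
  map `f : P → N` (hypersurface data) and `v ∈ T_y P`, `y` an interior point of `P`;
* `secondFundamentalForm_comap` — `K^{Φ^*g}_{f, ν} = K^{g}_{Φ ∘ f, dΦ ν}` on `T_y P`;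
* `inducedBilin_comap` (`f^*(Φ^*g) = (Φ ∘ f)^* g`), `sharp_congr` / `trace_congr` (the metric
  trace at a point only depends on the metric at that point) and `meanCurvature_comap` —
  `H^{Φ^*g}_{f, ν} = H^{g}_{Φ ∘ f, dΦ ν}`.

No boundarylessness is assumed on `N` (the application has `N` = a manifold with boundary, `P` its
boundary, `M` a round sphere).

## References

* B. O'Neill, *Semi-Riemannian geometry* (1983), Ch. 3, Prop. 3.18 (induced covariant derivative
  along a curve, uniqueness), Prop. 3.59 and Cor. 3.60–3.61 (isometries preserve the Levi-Civita
  connection), pp. 90–91 (local isometries); Ch. 4, pp. 98–100, Lemma 4.4 ff. (shape tensor).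
-/

noncomputable section

open Bundle Set Function Filter FiberBundle VectorField ContinuousLinearMap
open scoped Manifold ContDiff Topology

namespace Literature.Geometry.Lorentzian

namespace PseudoRiemannianMetric

section Congr

variable {E : Type*} [NormedAddCommGroup E] [NormedSpace ℝ E] {H : Type*} [TopologicalSpace H]
  {I : ModelWithCorners ℝ E H} {M : Type*} [TopologicalSpace M] [ChartedSpace H M]
  [IsManifold I ∞ M] [FiniteDimensional ℝ E] {n : ℕ∞ω}

/-- The musical isomorphism `♯` at `b` depends on the metric only through its value `g_b` at `b`.
[folklore] -/
theorem sharp_congr {g₁ g₂ : PseudoRiemannianMetric I n E (TangentSpace I : M → Type _)}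
    {b : M} (h : g₁.val b = g₂.val b) : g₁.sharp b = g₂.sharp b := by
  refine LinearEquiv.ext fun α ↦ g₂.flat_injective b (LinearMap.ext fun w ↦ ?_)
  rw [flat_apply, flat_apply, val_sharp_apply, ← h, val_sharp_apply]

/-- The metric trace at `b` depends on the metric only through its value `g_b` at `b`.
[folklore] -/
theorem trace_congr {g₁ g₂ : PseudoRiemannianMetric I n E (TangentSpace I : M → Type _)}
    {b : M} (h : g₁.val b = g₂.val b) (T : LinearMap.BilinForm ℝ (TangentSpace I b)) :
    g₁.trace b T = g₂.trace b T := by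
  unfold trace
  rw [sharp_congr h]

end Congr

section Naturality

variable {E : Type*} [NormedAddCommGroup E] [NormedSpace ℝ E] {H : Type*} [TopologicalSpace H]
  {I : ModelWithCorners ℝ E H} {M : Type*} [TopologicalSpace M] [ChartedSpace H M]
  [IsManifold I ∞ M]
  {E' : Type*} [NormedAddCommGroup E'] [NormedSpace ℝ E'] {H' : Type*} [TopologicalSpace H']
  {I' : ModelWithCorners ℝ E' H'} {N : Type*} [TopologicalSpace N] [ChartedSpace H' N]
  [IsManifold I' ∞ N]
  [FiniteDimensional ℝ E] [FiniteDimensional ℝ E'] [CompleteSpace E] [CompleteSpace E']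
  (g : PseudoRiemannianMetric I ∞ E (TangentSpace I : M → Type _))
  {Φ : N → M} (hpb : contMDiff_pullbackBilin I M I' N ∞) (hΦ : ContMDiff I' I (∞ + 1) Φ)
  (hΦ' : ∀ u, Function.Injective (mfderiv I' I Φ u))
  (hdim : Module.finrank ℝ E' = Module.finrank ℝ E)

/-! ### The covariant derivative along a curve -/

omit [CompleteSpace E] in
include hΦ' in
/-- **Naturality of the induced covariant derivative along curves under local diffeomorphisms.**
For a smooth equidimensional immersion `Φ : N → M`, a smooth metric `g` on `M`, a curve `γ` in `N`
and a vector field `W` along `γ` whose lift `t ↦ (γ t, W t) ∈ TN` is differentiable at `t₀`,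
`dΦ_{γ t₀} (D^{Φ^*g} W/dt (t₀)) = D^{g} (dΦ W)/dt (t₀)`, the right-hand side computed along
`Φ ∘ γ`. Proof: write the canonical-frame formula for `D^{Φ^*g}W/dt` in the frame
`Φ^* s'ⱼ = (dΦ)⁻¹ s'ⱼ ∘ Φ` pulled back from the canonical frame `s'ⱼ` of `TM` at `Φ (γ t₀)` (the
change-of-frame computation of `covariantDerivAlongFrame_eq_of_mem_baseSet`: Leibniz rule,
additivity and locality of `∇^{Φ^*g}`); in that frame the coefficient functions of `W` are those
of `dΦ W` in `s'ⱼ`, and `∇^{Φ^*g}_v (Φ^* s'ⱼ) = (dΦ)⁻¹ ∇^g_{dΦ v} s'ⱼ`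
(`leviCivita_comap_mpullback_apply`). O'Neill 1983, Ch. 3, Prop. 3.59 (isometries preserve the
Levi-Civita connection) with Prop. 3.18 (the induced covariant derivative is determined by
linearity, the Leibniz rule and `(Y ∘ γ)' = ∇_{γ'} Y`). [cite: ONeill1983, Ch. 3, Prop. 3.59 and Prop. 3.18] -/
theorem mfderiv_covariantDerivAlong_comap [g.HasLeviCivita]
    [(g.comap hpb Φ hΦ hΦ' hdim).HasLeviCivita]
    {γ : ℝ → N} {W : Π t : ℝ, TangentSpace I' (γ t)} {t₀ : ℝ}
    (hW : MDifferentiableAt 𝓘(ℝ, ℝ) I'.tangent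
      (fun t ↦ (TotalSpace.mk' E' (γ t) (W t) : TangentBundle I' N)) t₀) :
    mfderiv I' I Φ (γ t₀)
        (covariantDerivAlong (g.comap hpb Φ hΦ hΦ' hdim).leviCivita γ W t₀) =
      covariantDerivAlong g.leviCivita (Φ ∘ γ) (fun t ↦ mfderiv I' I Φ (γ t) (W t)) t₀ := by
  set gN := g.comap hpb Φ hΦ hΦ' hdim with hgN
  have hΦs : ContMDiff I' I ∞ Φ := hΦ.of_le le_self_add
  have hinv : ∀ u, (mfderiv I' I Φ u).IsInvertible := fun u ↦
    isInvertible_mfderiv_of_injective hdim (hΦ' u)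
  have hγ : MDifferentiableAt 𝓘(ℝ, ℝ) I' γ t₀ := mdifferentiableAt_of_mdifferentiableAt_lift hW
  have h2 : (1 : ℕ∞ω) + 1 ≤ ∞ := by
    rw [one_add_one_eq_two]
    exact WithTop.coe_le_coe.mpr le_top
  have hΦγ : MDifferentiableAt I' I Φ (γ t₀) := (hΦs (γ t₀)).mdifferentiableAt (by simp)
  -- the lift of `dΦ W` along `Φ ∘ γ` is the tangent map of `Φ` applied to the lift of `W`
  have hW' : MDifferentiableAt 𝓘(ℝ, ℝ) I.tangent
      (fun t ↦ (TotalSpace.mk' E (Φ (γ t)) (mfderiv I' I Φ (γ t) (W t)) : TangentBundle I M))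
      t₀ := by
    have htm : ContMDiff I'.tangent I.tangent ∞ (tangentMap I' I Φ) :=
      hΦ.contMDiff_tangentMap le_rfl
    have := ((htm _).mdifferentiableAt (by simp)).comp t₀ hW
    exact this
  -- the two canonical frames, the pulled-back frame, coefficient functions
  set e := trivializationAt E' (TangentSpace I' : N → Type _) (γ t₀) with he_def
  set e' := trivializationAt E (TangentSpace I : M → Type _) (Φ (γ t₀)) with he'_def
  set b := Module.finBasis ℝ E' with hb_def
  set b' := Module.finBasis ℝ E with hb'_def
  have he : γ t₀ ∈ e.baseSet := FiberBundle.mem_baseSet_trivializationAt' (γ t₀)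
  have he' : Φ (γ t₀) ∈ e'.baseSet := FiberBundle.mem_baseSet_trivializationAt' (Φ (γ t₀))
  set s : Fin (Module.finrank ℝ E') → Π y : N, TangentSpace I' y := e.localFrame b with hs_def
  set s' : Fin (Module.finrank ℝ E) → Π x : M, TangentSpace I x := e'.localFrame b' with hs'_def
  set S' : Fin (Module.finrank ℝ E) → Π y : N, TangentSpace I' y :=
    fun j ↦ mpullback I' I Φ (s' j) with hS'_def
  set a : Fin (Module.finrank ℝ E') → Fin (Module.finrank ℝ E) → N → ℝ :=
    fun i j y ↦ e.localFrame_coeff I' b i y (S' j y) with ha_def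
  set c : Fin (Module.finrank ℝ E') → ℝ → ℝ :=
    fun i t ↦ e.localFrame_coeff I' b i (γ t) (W t) with hc_def
  set c' : Fin (Module.finrank ℝ E) → ℝ → ℝ :=
    fun j t ↦ e'.localFrame_coeff I b' j (Φ (γ t)) (mfderiv I' I Φ (γ t) (W t)) with hc'_def
  set v : TangentSpace I' (γ t₀) := velocity I' γ t₀ with hv_def
  -- velocity of `Φ ∘ γ`
  have hvel : velocity I (Φ ∘ γ) t₀ = mfderiv I' I Φ (γ t₀) v := by
    simp only [velocity, hv_def]
    rw [mfderiv_comp t₀ hΦγ hγ]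
    rfl
  -- the open set on which both frames are available
  set U : Set N := e.baseSet ∩ Φ ⁻¹' e'.baseSet with hU_def
  have hU : IsOpen U := e.open_baseSet.inter (e'.open_baseSet.preimage hΦs.continuous)
  have hγU : γ t₀ ∈ U := ⟨he, he'⟩
  have hUn : U ∈ 𝓝 (γ t₀) := hU.mem_nhds hγU
  -- smoothness of the frames and of the change-of-frame coefficients
  have hs : ∀ i, MDiffAt (T% (s i)) (γ t₀) := fun i ↦
    (contMDiffAt_localFrame_of_mem 1 e b i he).mdifferentiableAt one_ne_zero
  have hs' : ∀ j, MDiffAt (T% (s' j)) (Φ (γ t₀)) := fun j ↦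
    (contMDiffAt_localFrame_of_mem 1 e' b' j he').mdifferentiableAt one_ne_zero
  have hS'U : ∀ j, CMDiff[U] 1 (T% (S' j)) := fun j ↦ by
    have h1 : CMDiff[Φ ⁻¹' e'.baseSet] 1 (T% (S' j)) :=
      ContMDiffOn.mpullback_vectorField_preimage (e'.contMDiffOn_localFrame_baseSet 1 b' j) hΦs
        (fun x _ ↦ hinv x) h2
    exact h1.mono inter_subset_right
  have hS' : ∀ j, MDiffAt (T% (S' j)) (γ t₀) := fun j ↦
    ((hS'U j).contMDiffAt hUn).mdifferentiableAt one_ne_zero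
  have ha : ∀ i j, MDifferentiableAt I' 𝓘(ℝ, ℝ) (a i j) (γ t₀) := fun i j ↦ by
    have h2 := contMDiffOn_localFrame_coeff (I := I') (e := e) b hU inter_subset_left (hS'U j) i
    exact (h2.contMDiffAt hUn).mdifferentiableAt one_ne_zero
  -- (1) expansion of the pulled-back frame in the canonical frame of `TN`
  have hF1 : ∀ j, ∀ y ∈ e.baseSet, S' j y = ∑ i, a i j y • s i y := fun j y hy ↦
    e.eq_sum_localFrame_coeff_smul (I := I') (b := b) (s := S' j) hy
  -- (2) the coefficient functions: those of `W` in `Φ^* s'` are those of `dΦ W` in `s'`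
  have hγUev : ∀ᶠ t in 𝓝 t₀, γ t ∈ U := hγ.continuousAt.preimage_mem_nhds hUn
  have hF4 : ∀ i t, γ t ∈ U → c i t = ∑ j, c' j t * a i j (γ t) := by
    intro i t ht
    have hWt' : mfderiv I' I Φ (γ t) (W t) = ∑ j, c' j t • s' j (Φ (γ t)) := by
      have := e'.eq_sum_localFrame_coeff_smul (I := I) (b := b')
        (s := fun _ ↦ mfderiv I' I Φ (γ t) (W t)) ht.2
      simpa only using this
    have hWt : W t = ∑ j, c' j t • S' j (γ t) := by
      have h1 : W t = (mfderiv I' I Φ (γ t)).inverse (mfderiv I' I Φ (γ t) (W t)) :=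
        ((hinv (γ t)).inverse_apply_self (W t)).symm
      rw [h1, hWt', map_sum]
      refine Finset.sum_congr rfl fun j _ ↦ ?_
      rw [map_smul]
      rfl
    simp only [hc_def, ha_def]
    rw [hWt, map_sum]
    simp only [map_smul, smul_eq_mul]
  -- (3) differentiability of the coefficient functions `c' j` at `t₀`
  have hc'_diff : ∀ j, DifferentiableAt ℝ (c' j) t₀ := fun j ↦ by
    have h1 := differentiableAt_trivialization_lift e' hW' he'
    have h2 : DifferentiableAt ℝ
        (fun t ↦ b'.coord j ((e' (TotalSpace.mk' E (Φ (γ t))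
          (mfderiv I' I Φ (γ t) (W t)))).2)) t₀ :=
      (LinearMap.toContinuousLinearMap (b'.coord j)).differentiableAt.comp t₀ h1
    refine h2.congr_of_eventuallyEq ?_
    filter_upwards [hγUev] with t ht
    simp only [hc'_def]
    rw [e'.localFrame_coeff_eq_coeff (I := I) (b := b')
      (s := fun _ ↦ mfderiv I' I Φ (γ t) (W t)) ht.2]
    simp
  -- (4) chain rule for `a i j ∘ γ`
  set da : Fin (Module.finrank ℝ E') → Fin (Module.finrank ℝ E) → ℝ :=
    fun i j ↦ mfderiv I' 𝓘(ℝ, ℝ) (a i j) (γ t₀) v with hda_def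
  have ha_deriv : ∀ i j, HasDerivAt (fun t ↦ a i j (γ t)) (da i j) t₀ :=
    fun i j ↦ hasDerivAt_comp_curve (ha i j) hγ
  -- (5) derivative of `c i` at `t₀`
  have hc_deriv : ∀ i, deriv (c i) t₀ = ∑ j, (deriv (c' j) t₀ * a i j (γ t₀)
      + c' j t₀ * da i j) := by
    intro i
    have hc_eq : c i =ᶠ[𝓝 t₀] fun t ↦ ∑ j, c' j t * a i j (γ t) := by
      filter_upwards [hγUev] with t ht
      exact hF4 i t ht
    rw [hc_eq.deriv_eq]
    exact (HasDerivAt.fun_sum fun j _ ↦ (hc'_diff j).hasDerivAt.mul (ha_deriv i j)).deriv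
  -- (6) the covariant derivative of `Φ^* s'ⱼ = ∑ i, a i j • s i` (locality, additivity, Leibniz)
  have hF8 : ∀ j, gN.leviCivita (S' j) (γ t₀) v =
      ∑ i, (a i j (γ t₀) • gN.leviCivita (s i) (γ t₀) v + da i j • s i (γ t₀)) := by
    intro j
    have hσ : ∀ i, MDiffAt (T% ((a i j) • (s i))) (γ t₀) := fun i ↦ (ha i j).smul_section (hs i)
    have hsum : MDiffAt (T% (∑ i, (a i j) • (s i))) (γ t₀) := by
      have := MDifferentiableAt.sum_section (I := I') (E := (TangentSpace I' : N → Type _))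
        (s := Finset.univ) (t := fun i ↦ (a i j) • (s i)) (x₀ := γ t₀) (fun i _ ↦ hσ i)
      convert this using 2
      ext
      · rfl
      · simp [Finset.sum_apply]
    have h1 : gN.leviCivita (S' j) (γ t₀) = gN.leviCivita (∑ i, (a i j) • (s i)) (γ t₀) := by
      refine gN.leviCivita.isCovariantDerivativeOn.congr_of_eventuallyEq (s := univ) (hS' j) hsum
        univ_mem ?_
      filter_upwards [e.open_baseSet.mem_nhds he] with y hy
      rw [hF1 j y hy]
      simp [Finset.sum_apply]
    rw [h1, covariantDerivative_finset_sum gN.leviCivita _ _ (fun i _ ↦ hσ i), _root_.sum_apply]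
    refine Finset.sum_congr rfl fun i _ ↦ ?_
    rw [gN.leviCivita.isCovariantDerivativeOn.leibniz (hs i) (ha i j)]
    simp only [_root_.add_apply, FunLike.coe_smul, Pi.smul_apply,
      ContinuousLinearMap.smulRight_apply]
    rfl
  -- (7) the canonical-frame formula for `D^{Φ^*g}W/dt` rewritten in the pulled-back frame
  have hF4₀ : ∀ i, c i t₀ = ∑ j, c' j t₀ * a i j (γ t₀) := fun i ↦ hF4 i t₀ hγU
  have hframe : covariantDerivAlong gN.leviCivita γ W t₀ =
      ∑ j, deriv (c' j) t₀ • S' j (γ t₀) + ∑ j, c' j t₀ • gN.leviCivita (S' j) (γ t₀) v := by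
    change ∑ i, deriv (c i) t₀ • s i (γ t₀) + ∑ i, c i t₀ • gN.leviCivita (s i) (γ t₀) v = _
    simp only [hc_deriv, hF4₀]
    exact (frame_change_algebra (fun i ↦ s i (γ t₀)) (fun i ↦ gN.leviCivita (s i) (γ t₀) v)
      (fun j ↦ S' j (γ t₀)) (fun j ↦ gN.leviCivita (S' j) (γ t₀) v) (fun i j ↦ a i j (γ t₀)) da
      (fun j ↦ c' j t₀) (fun j ↦ deriv (c' j) t₀) (fun j ↦ hF1 j _ he) hF8).symm
  -- (8) naturality of `∇` on the pulled-back frame, and `dΦ (Φ^* s'ⱼ) = s'ⱼ`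
  have hnat : ∀ j, mfderiv I' I Φ (γ t₀) (gN.leviCivita (S' j) (γ t₀) v) =
      g.leviCivita (s' j) (Φ (γ t₀)) (mfderiv I' I Φ (γ t₀) v) := fun j ↦ by
    have h := g.leviCivita_comap_mpullback_apply hpb hΦ hΦ' hdim (hs' j) v
    change mfderiv I' I Φ (γ t₀) ((g.comap hpb Φ hΦ hΦ' hdim).leviCivita
      (mpullback I' I Φ (s' j)) (γ t₀) v) = _
    rw [h]
    exact (hinv (γ t₀)).self_apply_inverse _
  have hSs : ∀ j, mfderiv I' I Φ (γ t₀) (S' j (γ t₀)) = s' j (Φ (γ t₀)) := fun j ↦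
    mfderiv_mpullback_apply hΦ' hdim (s' j) (γ t₀)
  -- (9) assemble
  rw [hframe, map_add, map_sum, map_sum]
  simp only [map_smul, hnat, hSs]
  change _ = ∑ j, deriv (c' j) t₀ • s' j (Φ (γ t₀))
    + ∑ j, c' j t₀ • g.leviCivita (s' j) (Φ (γ t₀)) (velocity I (Φ ∘ γ) t₀)
  rw [hvel]

/-! ### Hypersurface data: normal derivative, second fundamental form, mean curvature -/

section Hypersurface

variable {E'' : Type*} [NormedAddCommGroup E''] [NormedSpace ℝ E''] {H'' : Type*}
  [TopologicalSpace H''] {I'' : ModelWithCorners ℝ E'' H''} {P : Type*} [TopologicalSpace P]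
  [ChartedSpace H'' P] [IsManifold I'' ∞ P]

omit [CompleteSpace E] in
include hΦ' in
/-- **Naturality of `D_v ν`.** For a field `ν` along `f : P → N`, differentiable at the interior
point `y` as a map `P → TN`, and `v ∈ T_y P`:
`dΦ_{f y} (D^{Φ^*g}_v ν) = D^{g}_v (dΦ ν)`, where `dΦ ν` is the field `y ↦ dΦ_{f y} (ν y)` along
`Φ ∘ f` (`mfderiv_covariantDerivAlong_comap` along the chart-straight curve of velocity `v`).
O'Neill 1983, Ch. 3, Prop. 3.59 with Ch. 4, Lemma 4.1 (the induced connection on vector fields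
along a submanifold). [cite: ONeill1983, Ch. 3, Prop. 3.59 and Ch. 4, Lemma 4.1] -/
theorem mfderiv_normalDerivAlong_comap [g.HasLeviCivita]
    [(g.comap hpb Φ hΦ hΦ' hdim).HasLeviCivita]
    {f : P → N} {ν : NormalField I' f} {y : P} (hy : I''.IsInteriorPoint y)
    (hν : MDifferentiableAt I'' I'.tangent
      (fun y ↦ (TotalSpace.mk' E' (f y) (ν y) : TangentBundle I' N)) y)
    (v : TangentSpace I'' y) :
    mfderiv I' I Φ (f y) ((g.comap hpb Φ hΦ hΦ' hdim).normalDerivAlong f ν y v) =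
      g.normalDerivAlong (Φ ∘ f) (fun y ↦ mfderiv I' I Φ (f y) (ν y)) y v := by
  haveI : IsManifold I'' 1 P := IsManifold.of_le (n := ∞) (by simp)
  set c : ℝ → P := curveThrough I'' y v with hc_def
  have hc0 : c 0 = y := curveThrough_zero I'' y v
  have hc : MDifferentiableAt 𝓘(ℝ, ℝ) I'' c 0 := mdifferentiableAt_curveThrough_zero hy v
  have hν' : MDifferentiableAt I'' I'.tangent
      (fun y ↦ (TotalSpace.mk' E' (f y) (ν y) : TangentBundle I' N)) (c 0) := by
    rw [hc0]; exact hν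
  have hW : MDifferentiableAt 𝓘(ℝ, ℝ) I'.tangent
      (fun t ↦ (TotalSpace.mk' E' ((f ∘ c) t) (ν (c t)) : TangentBundle I' N)) 0 :=
    hν'.comp 0 hc
  have key := g.mfderiv_covariantDerivAlong_comap hpb hΦ hΦ' hdim (γ := f ∘ c)
    (W := fun t ↦ ν (c t)) hW
  have hpt : (f ∘ c) 0 = f y := by simp [hc0]
  simp only [normalDerivAlong]
  rw [← hc_def]
  rw [hpt] at key
  exact key

omit [CompleteSpace E] in
include hΦ' in
/-- **Naturality of the second fundamental form under local diffeomorphisms**: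
`K^{Φ^*g}_{f, ν}(v, w) = K^{g}_{Φ ∘ f, dΦ ν}(v, w)` on `T_y P`, for `ν` differentiable at the
interior point `y` as a map `P → TN` (both forms are the bilinear forms agreeing with
`g(D_{bᵢ} ν, df w)` on the canonical basis `bᵢ` of `T_y P`; use `mfderiv_normalDerivAlong_comap`,
`(Φ^*g)(u, u') = g(dΦ u, dΦ u')` and the chain rule `d(Φ ∘ f) = dΦ ∘ df`). O'Neill 1983, Ch. 4,
Lemma 4.4 ff. (shape tensor) with Ch. 3, Prop. 3.59. [cite: ONeill1983, Ch. 3, Prop. 3.59 and Ch. 4, Lemma 4.4] -/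
theorem secondFundamentalForm_comap [FiniteDimensional ℝ E''] [g.HasLeviCivita]
    [(g.comap hpb Φ hΦ hΦ' hdim).HasLeviCivita]
    {f : P → N} {ν : NormalField I' f} {y : P} (hy : I''.IsInteriorPoint y)
    (hν : MDifferentiableAt I'' I'.tangent
      (fun y ↦ (TotalSpace.mk' E' (f y) (ν y) : TangentBundle I' N)) y) :
    (g.comap hpb Φ hΦ hΦ' hdim).secondFundamentalForm I'' f ν y =
      g.secondFundamentalForm I'' (Φ ∘ f) (fun y ↦ mfderiv I' I Φ (f y) (ν y)) y := by
  haveI : FiniteDimensional ℝ (TangentSpace I'' y) := inferInstanceAs (FiniteDimensional ℝ E'')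
  have hΦs : ContMDiff I' I ∞ Φ := hΦ.of_le le_self_add
  have hf : MDifferentiableAt I'' I' f y := ((mdifferentiableAt_totalSpace I' _).1 hν).1
  have hΦf : MDifferentiableAt I' I Φ (f y) := (hΦs (f y)).mdifferentiableAt (by simp)
  have hchain : ∀ w : TangentSpace I'' y,
      mfderiv I'' I (Φ ∘ f) y w = mfderiv I' I Φ (f y) (mfderiv I'' I' f y w) := fun w ↦ by
    rw [mfderiv_comp y hΦf hf]; rfl
  refine (Module.finBasis ℝ (TangentSpace I'' y)).ext fun i ↦ LinearMap.ext fun w ↦ ?_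
  rw [secondFundamentalForm_apply_basis, secondFundamentalForm_apply_basis, val_comap,
    pullbackBilin_apply, g.mfderiv_normalDerivAlong_comap hpb hΦ hΦ' hdim hy hν, hchain]
  rfl

omit [CompleteSpace E] [CompleteSpace E'] [IsManifold I'' ∞ P] in
/-- The induced form is natural: `f^*(Φ^* g) = (Φ ∘ f)^* g` at every point where `f` is
differentiable (chain rule). O'Neill 1983, Ch. 3, p. 58 (functoriality of pullback).
[cite: ONeill1983, Ch. 3, p. 58] -/
theorem inducedBilin_comap {f : P → N} {y : P} (hf : MDifferentiableAt I'' I' f y)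
    (hΦf : MDifferentiableAt I' I Φ (f y)) :
    (g.comap hpb Φ hΦ hΦ' hdim).inducedBilin I'' f y = g.inducedBilin I'' (Φ ∘ f) y := by
  ext v w
  rw [inducedBilin_apply, inducedBilin_apply, val_comap, pullbackBilin_apply,
    mfderiv_comp y hΦf hf]
  rfl

omit [CompleteSpace E] in
include hΦ' in
/-- **Naturality of the mean curvature under local diffeomorphisms**:
`H^{Φ^*g}_{f, ν}(y) = H^{g}_{Φ ∘ f, dΦ ν}(y)` for spacelike immersions `f : P → (N, Φ^*g)` and
`Φ ∘ f : P → (M, g)` and a field `ν` along `f` differentiable at the interior point `y` (the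
induced metrics agree, `inducedBilin_comap`, and so do the second fundamental forms,
`secondFundamentalForm_comap`). O'Neill 1983, Ch. 4, p. 111 ff. with Ch. 3, Prop. 3.59.
[cite: ONeill1983, Ch. 3, Prop. 3.59 and Ch. 4, Lemma 4.4] -/
theorem meanCurvature_comap [FiniteDimensional ℝ E''] [g.HasLeviCivita]
    [(g.comap hpb Φ hΦ hΦ' hdim).HasLeviCivita]
    (hpbN : contMDiff_pullbackBilin I' N I'' P ∞) (hpbM : contMDiff_pullbackBilin I M I'' P ∞)
    {f : P → N} (hf : (g.comap hpb Φ hΦ hΦ' hdim).IsSpacelikeImmersion I'' f)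
    (hΦf : g.IsSpacelikeImmersion I'' (Φ ∘ f))
    {ν : NormalField I' f} {y : P} (hy : I''.IsInteriorPoint y)
    (hν : MDifferentiableAt I'' I'.tangent
      (fun y ↦ (TotalSpace.mk' E' (f y) (ν y) : TangentBundle I' N)) y) :
    (g.comap hpb Φ hΦ hΦ' hdim).meanCurvature f hpbN hf ν y =
      g.meanCurvature (Φ ∘ f) hpbM hΦf (fun y ↦ mfderiv I' I Φ (f y) (ν y)) y := by
  have hΦs : ContMDiff I' I ∞ Φ := hΦ.of_le le_self_add
  have hfd : MDifferentiableAt I'' I' f y := ((mdifferentiableAt_totalSpace I' _).1 hν).1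
  have hΦfd : MDifferentiableAt I' I Φ (f y) := (hΦs (f y)).mdifferentiableAt (by simp)
  have hval : ((g.comap hpb Φ hΦ hΦ' hdim).inducedMetric f hpbN hf).val y =
      (g.inducedMetric (Φ ∘ f) hpbM hΦf).val y := by
    rw [inducedMetric_val, inducedMetric_val, g.inducedBilin_comap hpb hΦ hΦ' hdim hfd hΦfd]
  rw [meanCurvature, meanCurvature, trace_congr hval,
    g.secondFundamentalForm_comap hpb hΦ hΦ' hdim hy hν]

end Hypersurface

end Naturality

end PseudoRiemannianMetric

end Literature.Geometry.Lorentzian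

end
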